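import Literature.NumberTheory.Sieve.FordMaynardLevelHalfSieve
import Literature.NumberTheory.Sieve.DivisorPowerSums
import Mathlib.NumberTheory.Bertrand
import HarnessLib

/-!
# Ford–Maynard: prime-free admissible sequences force `C⁻(γ, θ, ν) = 0` — the reading over the
# tree's transcription `IsLowerSieveConst` (PROVED glue; no named fact)

K. Ford, J. Maynard, *On the theory of prime producing sieves* (arXiv:2407.14368, 2024) phrase
their negative results as `C⁻(P) = 0` (Theorems 2.1, 4.16, 2.7 (c); Definition 4.8): "Type-I/II
information of that strength cannot force a single prime". The tree carries two transcriptions of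
the two sides of this sentence:

* `Literature.Barriers.Parity.FordMaynard.PrimeFreeAdmissible γ θ ν B`
  (`Literature/Barriers/Parity/FordMaynardPrimeSieves.lean`): eventually in `x` there is a bounded
  non-negative sequence `a` with `w = a − 1` satisfying (I) at level `x^γ` and (II) on
  `((x/2)^θ, x^{θ+ν}]` with exponent `B`, and `a_p = 0` for every prime `p ∈ (x/2, x]` — the
  conclusion shape of Theorems 2.1 / 4.16 / 6.3 (a) (`primeFreeAdmissible_of_vecFn`,
  `FordMaynardConstruction.lean`, proves it from a Type-I compatible function);
* `Literature.NumberTheory.Sieve.FordMaynard.IsLowerSieveConst γ θ ν c`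
  (`FordMaynardLevelHalfSieve.lean`): `c` is an admissible lower-bound sieve constant in the sense
  of Definition 4.8 unfolded on the pairs `(a, 1)` (for every `ϖ > 1` some `B > 0` works).

This file PROVES the one-line bridge between them which the printed text uses silently
("in particular `C⁻(P) = 0`"): if prime-free admissible sequences exist for EVERY `B > 0`, then no
`c > 0` is an admissible lower-bound sieve constant (`IsLowerSieveConst.nonpos_of_primeFreeAdmissible`,
`not_isLowerSieveConst_of_primeFreeAdmissible`). The only content is bookkeeping: a `C`-bounded
`w` satisfies Ford–Maynard's growth condition (w) with exponent `ϖ = 5` for large `x`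
(`exists_growthBound_of_abs_le`, from the tree's divisor moment
`Literature.NumberTheory.Sieve.exists_sum_sigma_zero_pow_le`), and the window `(x/2, x]` contains
a prime for `x ≥ 2` (a private lemma, Bertrand's postulate from Mathlib), so that
`∑_{x/2 < p ≤ x} a_p = 0 < c · #{p ∈ (x/2, x]}` is impossible. The companion statement with
`c·x/log x` in place of `c · #{x/2 < p ≤ x}` and without (w) is the tree's
`Literature.Barriers.Parity.FordMaynard.no_lower_bound_of_primeFree`.

Use (cell `parity-ideate`, seat p3, f-side of Theorem 2.7 (c)): a certified Type-I compatible
function `f` with `f ≥ −1`, `f(1) < −1` at `P = (1/2, 0, ν₀)` gives, through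
`primeFreeAdmissible_of_vecFn`, `PrimeFreeAdmissible (1/2) 0 ν₀ B` for all `B`, hence by this file
`∀ c, IsLowerSieveConst (1/2) 0 ν₀ c → c ≤ 0` ("`C⁻(1/2, 0, ν₀) = 0`", the shape of Theorem 2.7 (c)).

## References

* K. Ford, J. Maynard, *On the theory of prime producing sieves*, arXiv:2407.14368v1 (2024):
  Definition 4.8 (`C⁻`), §2 (w), Theorem 2.1 and Theorem 6.3 (b) ("`C⁻(P) ≤ 1 + f(1)`"), proof of
  Theorem 2.7 (c) (p. 48). (`lit read arxiv:2407.14368`, chunks p0012–p0013, p0022, p0048.)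
  [FordMaynard2024PrimeSieves]
-/

noncomputable section

open Finset
open Literature.Barriers.Parity
open scoped ArithmeticFunction.sigma

namespace Literature.NumberTheory.Sieve.FordMaynard

/-- For `x ≥ 2` the window `(x/2, x]` contains a prime (Bertrand's postulate, Mathlib
`Nat.exists_prime_lt_and_le_two_mul`, applied to `n = ⌊x/2⌋`). [folklore] -/
private theorem windowPrimes_nonempty {x : ℝ} (hx : 2 ≤ x) : (windowPrimes x).Nonempty := by
  set n : ℕ := ⌊x / 2⌋₊ with hn
  have hn1 : 1 ≤ n := Nat.le_floor (by norm_num; linarith)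
  obtain ⟨p, hp, hnp, hp2n⟩ := Nat.exists_prime_lt_and_le_two_mul n (by omega)
  refine ⟨p, mem_windowPrimes.2 ⟨hp, ?_, ?_⟩⟩
  · have h1 : x / 2 < (n : ℝ) + 1 := Nat.lt_floor_add_one (x / 2)
    have h2 : (n : ℝ) + 1 ≤ p := by exact_mod_cast hnp
    linarith
  · have h1 : (p : ℝ) ≤ 2 * n := by exact_mod_cast hp2n
    have h2 : (n : ℝ) ≤ x / 2 := Nat.floor_le (by linarith)
    linarith

/-- A `C`-bounded sequence `w` satisfies Ford–Maynard's growth condition (w),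
`∑_{x/2 < n ≤ x} |w_n| τ(n) ≤ x (log x)^ϖ`, with `ϖ = 5` for all large `x` (depending on `C`):
`∑_{n ≤ x} τ(n) ≪ x (log x)^4` by the tree's divisor moments. (Ford–Maynard, §2.3: the growth
condition "automatically" holds for divisor-bounded `w` when `ϖ` is large; here `w` is even
bounded.) [cite: FordMaynard2024PrimeSieves, §2 (w) and §2.3] -/
theorem exists_growthBound_of_abs_le (C : ℝ) :
    ∃ x₀ : ℝ, ∀ x : ℝ, x₀ ≤ x → ∀ w : ℕ → ℝ, (∀ n, |w n| ≤ C) → GrowthBound w x 5 := by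
  obtain ⟨K, hK, hsum⟩ := Literature.NumberTheory.Sieve.exists_sum_sigma_zero_pow_le 1
  refine ⟨max 2 (Real.exp (max C 0 * K + 1)), fun x hx w hw => ?_⟩
  have hx2 : (2 : ℝ) ≤ x := le_trans (le_max_left _ _) hx
  have hxexp : Real.exp (max C 0 * K + 1) ≤ x := le_trans (le_max_right _ _) hx
  have hx0 : (0 : ℝ) ≤ x := by linarith
  set X : ℕ := ⌊x⌋₊ with hX
  have hX2 : 2 ≤ X := Nat.le_floor (by exact_mod_cast hx2)
  have hXx : (X : ℝ) ≤ x := Nat.floor_le hx0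
  have hX0 : (0 : ℝ) < X := by exact_mod_cast (lt_of_lt_of_le (by norm_num) hX2)
  have hlogX0 : 0 ≤ Real.log X := Real.log_nonneg (by exact_mod_cast le_trans (by norm_num) hX2)
  have hlogXx : Real.log X ≤ Real.log x := Real.log_le_log hX0 hXx
  have hlogx : max C 0 * K + 1 ≤ Real.log x := by
    have := Real.log_le_log (Real.exp_pos _) hxexp
    rwa [Real.log_exp] at this
  have hC0 : 0 ≤ max C 0 := le_max_right _ _
  unfold GrowthBound
  calc ∑ n ∈ (Icc 1 X).filter (fun n : ℕ => x / 2 < (n : ℝ)), |w n| * (n.divisors.card : ℝ)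
      ≤ ∑ n ∈ Icc 1 X, |w n| * (n.divisors.card : ℝ) :=
        sum_le_sum_of_subset_of_nonneg (filter_subset _ _) fun n _ _ => by positivity
    _ ≤ ∑ n ∈ Icc 1 X, max C 0 * ((σ 0 n : ℝ) ^ 1) := by
        refine sum_le_sum fun n _ => ?_
        rw [pow_one, ArithmeticFunction.sigma_zero_apply]
        exact mul_le_mul_of_nonneg_right ((hw n).trans (le_max_left _ _)) (by positivity)
    _ = max C 0 * ∑ n ∈ Icc 1 X, (σ 0 n : ℝ) ^ 1 := by rw [mul_sum]
    _ ≤ max C 0 * (K * X * Real.log X ^ (2 ^ (1 + 1))) :=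
        mul_le_mul_of_nonneg_left (hsum X hX2) hC0
    _ = (max C 0 * K) * X * Real.log X ^ 4 := by norm_num; ring
    _ ≤ Real.log x * x * Real.log x ^ 4 := by
        have h1 : max C 0 * K ≤ Real.log x := by linarith
        have h2 : Real.log X ^ 4 ≤ Real.log x ^ 4 := pow_le_pow_left₀ hlogX0 hlogXx 4
        have h3 : 0 ≤ max C 0 * K := mul_nonneg hC0 hK.le
        have hlogx0 : 0 ≤ Real.log x := Real.log_nonneg (by linarith)
        have h4 : max C 0 * K * (X : ℝ) ≤ Real.log x * x :=
          mul_le_mul h1 hXx hX0.le hlogx0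
        exact mul_le_mul h4 h2 (pow_nonneg hlogX0 4) (mul_nonneg hlogx0 hx0)
    _ = x * Real.log x ^ (5 : ℝ) := by
        rw [show (5 : ℝ) = ((5 : ℕ) : ℝ) by norm_num, Real.rpow_natCast]
        ring

/-- **Prime-free admissible sequences for every `B` force `C⁻(γ, θ, ν) = 0`**, over the tree's
transcription of Definition 4.8: if `PrimeFreeAdmissible γ θ ν B` holds for every `B > 0`, then
every admissible lower-bound sieve constant `c` (`IsLowerSieveConst γ θ ν c`) satisfies `c ≤ 0`.
(Ford–Maynard state their constructions as "`C⁻(P) = 0`" / "`C⁻(P) ≤ 1 + f(1)`".)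
[cite: FordMaynard2024PrimeSieves, Definition 4.8, Theorem 2.1 and Theorem 6.3 (b)] -/
theorem IsLowerSieveConst.nonpos_of_primeFreeAdmissible {γ θ ν c : ℝ}
    (hpf : ∀ B : ℝ, 0 < B → FordMaynard.PrimeFreeAdmissible γ θ ν B) (hc : IsLowerSieveConst γ θ ν c) :
    c ≤ 0 := by
  by_contra hc0'
  have hc0 : 0 < c := not_le.1 hc0'
  obtain ⟨B, x₀, hB, hx₀⟩ := hc 5 (by norm_num)
  obtain ⟨C, x₁, hx₁⟩ := hpf B hB
  obtain ⟨x₂, hx₂⟩ := exists_growthBound_of_abs_le (max C 1)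
  set x : ℝ := max (max x₀ x₁) (max x₂ 2) with hxdef
  have hxx₀ : x₀ ≤ x := le_trans (le_max_left _ _) (le_max_left _ _)
  have hxx₁ : x₁ ≤ x := le_trans (le_max_right _ _) (le_max_left _ _)
  have hxx₂ : x₂ ≤ x := le_trans (le_max_left _ _) (le_max_right _ _)
  have hx2 : (2 : ℝ) ≤ x := le_trans (le_max_right _ _) (le_max_right _ _)
  obtain ⟨a, ha, hI, hII, hprime⟩ := hx₁ x hxx₁
  have hw : ∀ n, |a n - 1| ≤ max C 1 := fun n => by
    obtain ⟨h0, hC⟩ := ha n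
    rw [abs_le]
    constructor
    · linarith [le_max_right C 1]
    · linarith [le_max_left C 1]
  have hG : GrowthBound (fun n => a n - 1) x 5 := hx₂ x hxx₂ (fun n => a n - 1) hw
  have hle := hx₀ x hxx₀ a (fun n => (ha n).1) hG hI hII
  have hsum : ∑ p ∈ windowPrimes x, a p = 0 :=
    sum_eq_zero fun p hp => by
      obtain ⟨hpp, h1, h2⟩ := mem_windowPrimes.1 hp
      exact hprime p hpp h1 h2
  rw [hsum] at hle
  have hcard : (0 : ℝ) < ((windowPrimes x).card : ℝ) := by
    exact_mod_cast (windowPrimes_nonempty hx2).card_pos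
  exact absurd hle (not_le.2 (mul_pos hc0 hcard))

/-- Corollary in the negative form: under the same hypothesis no `c > 0` is an admissible
lower-bound sieve constant at `(γ, θ, ν)` ("`C⁻(γ, θ, ν) = 0`").
[cite: FordMaynard2024PrimeSieves, Definition 4.8 and Theorem 2.1] -/
theorem not_isLowerSieveConst_of_primeFreeAdmissible {γ θ ν c : ℝ}
    (hpf : ∀ B : ℝ, 0 < B → FordMaynard.PrimeFreeAdmissible γ θ ν B) (hc0 : 0 < c) :
    ¬ IsLowerSieveConst γ θ ν c :=
  fun hc => absurd (hc.nonpos_of_primeFreeAdmissible hpf) (not_le.2 hc0)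

end Literature.NumberTheory.Sieve.FordMaynard

end
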